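import Summits.QuantumAdvantage.AdviceFreeQNC0.AffBells37Kraft
import HarnessLib

/-!
# AffBells37 (2/6) — SPARSITY of cube-restricted character sums (Schwartz–Zippel over `{0,1}^F`)

Cell qa-qnc0, route DWalkThree (crux stmt-QuantumAdvantage-22907; rung (NP₁) `AffBells26.AffBellsPolyLoss3`).  AUTHORED AND PROVED BY THE PLANNER qa-qnc0-p2 gen 34 (memo `HOME/qa-qnc0-p2/ROUND-34P2.md`, INBOX P2-34a/b, 2026-08-29); landed verbatim by qn-prover-3.  Part 2/6 of the all-firsts PAIR-SLICING + `𝔽₄`-KRAFT proof of (NP₁); the six parts are a mechanical split (≤ 400 lines each) of one kernel-checked file `AffBells37.lean` (rc 0, 0 sorries, axioms propext/Classical.choice/Quot.sound).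

* `sparse` — if `f = Σ_{b∈s} c_b χ_{A_b} ≢ 0` on `{0,1}^F` then `#{u : f(u) ≠ 0} ≥ 2^F / 2^{L(|s|)}`, `L(K) = ⌈log_{3/2} K⌉`-type recursion
  (`L`, `L_le_log`, `two_pow_L_le : 2^{L K} ≤ 4K²`): restrict the majority letter of the first coordinate to kill `≥ 1/3` of the rows
  (`ev_kill_zero/one`, `exists_major_letter`), recurse on both sub-cubes.  `sparse_ne_one` — the same for `f ≢ 1` (add the row `−1·χ_0`).
WHAT THIS IS NOT: no statement about the game.
-/

noncomputable section

namespace Summit.QuantumAdvantage.AdviceFreeQNC0.AffBells37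

open Finset F4
open Classical

variable {F : ℕ} {ι : Type*}

/-! ### Sparsity: Schwartz–Zippel for cube-restricted character sums

`sparse` — if `f = Σ_{b ∈ s} c_b χ_{A_b}` is not identically zero on `{0,1}^F` then
`#{u : f u ≠ 0} · 2^{L |s|} ≥ 2^F`, where `L K = 0 (K ≤ 1)`, `L K = 1 + L ⌊2K/3⌋` (so
`2^{L K} ≤ 2K^{1.71}`).  Proof: split on the first letter; `f(0,·) = g₀+g₁+g₂`, `f(1,·) = g₀+ωg₁+ω²g₂`
(letter groups); if one of them vanishes identically, adding a multiple of it to the other kills the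
most frequent letter group, leaving `≤ ⌊2K/3⌋` terms.  Tight: `[u₁+u₂ ≡ 2] = u₁u₂` has `3` terms. -/

/-- The evaluation `f(u) = Σ_{b ∈ s} c_b χ_{A_b}(u)` of an indexed character family. -/
def ev (s : Finset ι) (A : ι → Fin F → ZMod 3) (c : ι → F4) (u : Fin F → Bool) : F4 :=
  ∑ b ∈ s, c b * chiZ (A b) u

/-- Restricting to first coordinate `false` drops the first letter of every row. -/
theorem ev_cons_false (s : Finset ι) (A : ι → Fin (F + 1) → ZMod 3) (c : ι → F4) (v : Fin F → Bool) :
    ev s A c (Fin.cons false v) = ev s (fun b => Fin.tail (A b)) c v := by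
  unfold ev
  refine sum_congr rfl fun b _ => ?_
  rw [chiZ_cons]
  simp only [Bool.false_eq_true, if_false, pow_zero, one_mul]

/-- Restricting to first coordinate `true` drops the first letter of every row and twists the coefficient by `ω^{A₀}`. -/
theorem ev_cons_true (s : Finset ι) (A : ι → Fin (F + 1) → ZMod 3) (c : ι → F4) (v : Fin F → Bool) :
    ev s A c (Fin.cons true v) = ev s (fun b => Fin.tail (A b)) (fun b => c b * ω ^ (A b 0).val) v := by
  unfold ev
  refine sum_congr rfl fun b _ => ?_
  rw [chiZ_cons, if_pos rfl]
  ring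

/-- Every point of the cube is `Fin.cons (u 0) (Fin.tail u)`: if both restrictions vanish, so does `f`. -/
theorem ev_eq_zero_of_restrictions (s : Finset ι) (A : ι → Fin (F + 1) → ZMod 3) (c : ι → F4)
    (h0 : ∀ v, ev s (fun b => Fin.tail (A b)) c v = 0)
    (h1 : ∀ v, ev s (fun b => Fin.tail (A b)) (fun b => c b * ω ^ (A b 0).val) v = 0)
    (u : Fin (F + 1) → Bool) : ev s A c u = 0 := by
  rw [← Fin.cons_self_tail u]
  cases u 0
  · rw [ev_cons_false]; exact h0 _
  · rw [ev_cons_true]; exact h1 _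

/-- Counting over the cube by the first coordinate. -/
theorem card_cube_succ (P : (Fin (F + 1) → Bool) → Prop) [DecidablePred P] :
    (univ.filter P).card
      = (univ.filter fun v : Fin F → Bool => P (Fin.cons false v)).card
        + (univ.filter fun v : Fin F → Bool => P (Fin.cons true v)).card := by
  rw [card_filter, card_filter, card_filter]
  rw [← Fintype.sum_equiv (Fin.consEquiv fun _ => Bool)
    (fun p : Bool × (Fin F → Bool) => if P (Fin.cons p.1 p.2) then 1 else 0) _ (fun p => rfl)]
  rw [Fintype.sum_prod_type]
  simp only [Fintype.sum_bool]
  rw [add_comm]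

/-- The sparsity exponent: `L K = 0` for `K ≤ 1`, `L K = 1 + L ⌊2K/3⌋` otherwise. -/
def L (K : ℕ) : ℕ := if K ≤ 1 then 0 else 1 + L (2 * K / 3)
termination_by K
decreasing_by omega

/-- `L K = 0` for `K ≤ 1`. -/
theorem L_of_le_one {K : ℕ} (h : K ≤ 1) : L K = 0 := by
  rw [L]; exact if_pos h

/-- The recursion `L K = 1 + L ⌊2K/3⌋` for `K ≥ 2`. -/
theorem L_of_two_le {K : ℕ} (h : 2 ≤ K) : L K = 1 + L (2 * K / 3) := by
  rw [L]; exact if_neg (by omega)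

/-- `L` is monotone. -/
theorem L_mono {K K' : ℕ} (h : K ≤ K') : L K ≤ L K' := by
  induction K' using Nat.strong_induction_on generalizing K with
  | _ K' ih =>
    by_cases h' : K' ≤ 1
    · rw [L_of_le_one h', L_of_le_one (h.trans h')]
    · rw [L_of_two_le (by omega : 2 ≤ K')]
      by_cases hK : K ≤ 1
      · rw [L_of_le_one hK]; exact Nat.zero_le _
      · rw [L_of_two_le (by omega : 2 ≤ K)]
        exact Nat.add_le_add_left (ih (2 * K' / 3) (by omega) (by omega)) 1

/-- Small values: `L 2 = 1`, `L 3 = 2`, `L 4 = 2` (so `2^{L 3} = 4`: the `K = 3` example is tight). -/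
theorem L_three : L 3 = 2 := by
  rw [L_of_two_le (by norm_num), show 2 * 3 / 3 = 2 from rfl, L_of_two_le le_rfl,
    show 2 * 2 / 3 = 1 from rfl, L_of_le_one le_rfl]

/-- Killing a letter group when `f(0,·) ≡ 0`: `f(1,·) = f(1,·) + ω^{t₀} f(0,·)` has no `t₀`-terms. -/
theorem ev_kill_zero (s : Finset ι) (tA : ι → Fin F → ZMod 3) (c : ι → F4) (t : ι → ZMod 3)
    (t₀ : ZMod 3) (h0 : ∀ v, ev s tA c v = 0) (v : Fin F → Bool) :
    ev s tA (fun b => c b * ω ^ (t b).val) v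
      = ev (s.filter fun b => t b ≠ t₀) tA (fun b => c b * (ω ^ (t b).val + ω ^ t₀.val)) v := by
  unfold ev at *
  rw [sum_filter]
  calc ∑ b ∈ s, c b * ω ^ (t b).val * chiZ (tA b) v
      = ∑ b ∈ s, c b * ω ^ (t b).val * chiZ (tA b) v + ω ^ t₀.val * ∑ b ∈ s, c b * chiZ (tA b) v := by
        rw [h0 v, mul_zero, add_zero]
    _ = ∑ b ∈ s, c b * (ω ^ (t b).val + ω ^ t₀.val) * chiZ (tA b) v := by
        rw [mul_sum, ← sum_add_distrib]
        refine sum_congr rfl fun b _ => ?_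
        ring
    _ = _ := by
        refine sum_congr rfl fun b _ => ?_
        by_cases hb : t b ≠ t₀
        · rw [if_pos hb]
        · rw [if_neg hb, not_not.1 hb, add_self, mul_zero, zero_mul]

/-- Killing a letter group when `f(1,·) ≡ 0`: `f(0,·) = f(0,·) + ω^{−t₀} f(1,·)` has no `t₀`-terms. -/
theorem ev_kill_one (s : Finset ι) (tA : ι → Fin F → ZMod 3) (c : ι → F4) (t : ι → ZMod 3)
    (t₀ : ZMod 3) (h1 : ∀ v, ev s tA (fun b => c b * ω ^ (t b).val) v = 0) (v : Fin F → Bool) :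
    ev s tA c v
      = ev (s.filter fun b => t b ≠ t₀) tA (fun b => c b * (1 + ω ^ (3 - t₀.val) * ω ^ (t b).val)) v := by
  unfold ev at *
  rw [sum_filter]
  calc ∑ b ∈ s, c b * chiZ (tA b) v
      = ∑ b ∈ s, c b * chiZ (tA b) v + ω ^ (3 - t₀.val) * ∑ b ∈ s, c b * ω ^ (t b).val * chiZ (tA b) v := by
        rw [h1 v, mul_zero, add_zero]
    _ = ∑ b ∈ s, c b * (1 + ω ^ (3 - t₀.val) * ω ^ (t b).val) * chiZ (tA b) v := by
        rw [mul_sum, ← sum_add_distrib]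
        refine sum_congr rfl fun b _ => ?_
        ring
    _ = _ := by
        refine sum_congr rfl fun b _ => ?_
        by_cases hb : t b ≠ t₀
        · rw [if_pos hb]
        · have hlt := ZMod.val_lt t₀
          rw [if_neg hb, not_not.1 hb, ← pow_add, Nat.sub_add_cancel (by omega), omega_pow_mod 3,
            show 3 % 3 = 0 from rfl, pow_zero, add_self, mul_zero, zero_mul]

/-- A most frequent letter: removing its group leaves at most `⌊2K/3⌋` indices. -/
theorem exists_major_letter (s : Finset ι) (t : ι → ZMod 3) :
    ∃ t₀ : ZMod 3, (s.filter fun b => t b ≠ t₀).card ≤ 2 * s.card / 3 := by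
  obtain ⟨t₀, -, hmax⟩ := exists_max_image (univ : Finset (ZMod 3))
    (fun r => (s.filter fun b => t b = r).card) univ_nonempty
  refine ⟨t₀, ?_⟩
  have hfib : s.card = ∑ r : ZMod 3, (s.filter fun b => t b = r).card :=
    card_eq_sum_card_fiberwise fun b _ => mem_univ (t b)
  have h3 : ∑ r : ZMod 3, (s.filter fun b => t b = r).card ≤ 3 * (s.filter fun b => t b = t₀).card := by
    calc ∑ r : ZMod 3, (s.filter fun b => t b = r).card
        ≤ ∑ _r : ZMod 3, (s.filter fun b => t b = t₀).card := sum_le_sum fun r _ => hmax r (mem_univ r)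
      _ = 3 * (s.filter fun b => t b = t₀).card := by rw [sum_const, card_univ, ZMod.card, smul_eq_mul]
  have hsplit := Finset.card_filter_add_card_filter_not (s := s) (fun b => t b = t₀)
  rw [Nat.le_div_iff_mul_le (by norm_num)]
  have he : (s.filter fun b => t b ≠ t₀) = s.filter fun b => ¬ t b = t₀ := rfl
  rw [he]
  omega

/-- **Sparsity lemma (character Schwartz–Zippel).**  A nonzero `K`-term cube-restricted character
sum on `{0,1}^F` is nonzero on at least `2^F / 2^{L K}` points. -/
theorem sparse (F : ℕ) : ∀ (s : Finset ι) (A : ι → Fin F → ZMod 3) (c : ι → F4),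
    (∃ u, ev s A c u ≠ 0) → 2 ^ F ≤ 2 ^ L s.card * (univ.filter fun u => ev s A c u ≠ 0).card := by
  induction F with
  | zero =>
    intro s A c hne
    obtain ⟨u, hu⟩ := hne
    have hpos : 0 < (univ.filter fun u => ev s A c u ≠ 0).card :=
      card_pos.2 ⟨u, mem_filter.2 ⟨mem_univ u, hu⟩⟩
    have h := Nat.mul_le_mul (Nat.one_le_two_pow (n := L s.card)) hpos
    rw [pow_zero]
    rw [one_mul] at h
    exact h
  | succ F ih =>
    intro s A c hne
    have e0 : ∀ v, ev s A c (Fin.cons false v) = ev s (fun b => Fin.tail (A b)) c v :=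
      ev_cons_false s A c
    have e1 : ∀ v, ev s A c (Fin.cons true v)
        = ev s (fun b => Fin.tail (A b)) (fun b => c b * ω ^ (A b 0).val) v := ev_cons_true s A c
    rw [card_cube_succ (fun u => ev s A c u ≠ 0)]
    simp only [e0, e1]
    obtain ⟨t₀, ht₀⟩ := exists_major_letter s (fun b => A b 0)
    -- the reduced index set and the exponent bookkeeping
    have hLK : ∀ (N : ℕ),
        2 * (2 ^ L (s.filter fun b => A b 0 ≠ t₀).card * N) ≤ 2 ^ L s.card * N ∨ s.card ≤ 1 := by
      intro N
      by_cases hK : s.card ≤ 1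
      · exact Or.inr hK
      · left
        have hL : 1 + L (s.filter fun b => A b 0 ≠ t₀).card ≤ L s.card := by
          rw [L_of_two_le (by omega : 2 ≤ s.card)]
          exact Nat.add_le_add_left (L_mono ht₀) 1
        have hp := Nat.pow_le_pow_right (by norm_num : 0 < 2) hL
        rw [pow_add, pow_one] at hp
        calc 2 * (2 ^ L (s.filter fun b => A b 0 ≠ t₀).card * N)
            = (2 * 2 ^ L (s.filter fun b => A b 0 ≠ t₀).card) * N := by ring
          _ ≤ 2 ^ L s.card * N := Nat.mul_le_mul_right N hp
    -- if `|s| ≤ 1` the reduced set is empty, so a reduced representation cannot be nonzero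
    have hempty : s.card ≤ 1 → ∀ (c' : ι → F4) (v : Fin F → Bool),
        ev (s.filter fun b => A b 0 ≠ t₀) (fun b => Fin.tail (A b)) c' v = 0 := by
      intro hK c' v
      have h0 : (s.filter fun b => A b 0 ≠ t₀).card = 0 := by omega
      rw [card_eq_zero] at h0
      unfold ev
      rw [h0, sum_empty]
    by_cases h0 : ∃ v, ev s (fun b => Fin.tail (A b)) c v ≠ 0
    · by_cases h1 : ∃ v, ev s (fun b => Fin.tail (A b)) (fun b => c b * ω ^ (A b 0).val) v ≠ 0
      · -- both restrictions are nonzero functions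
        have i0 := ih s _ _ h0
        have i1 := ih s _ _ h1
        calc 2 ^ (F + 1) = 2 ^ F + 2 ^ F := by rw [pow_succ, mul_two]
          _ ≤ _ := Nat.add_le_add i0 i1
          _ = _ := by rw [mul_add]
      · -- `f(1,·) ≡ 0`: kill the major letter group of `f(0,·)`
        push Not at h1
        have hk := ev_kill_one s (fun b => Fin.tail (A b)) c (fun b => A b 0) t₀ h1
        have h0' : ∃ v, ev (s.filter fun b => A b 0 ≠ t₀) (fun b => Fin.tail (A b))
            (fun b => c b * (1 + ω ^ (3 - t₀.val) * ω ^ (A b 0).val)) v ≠ 0 := by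
          obtain ⟨v, hv⟩ := h0
          exact ⟨v, by rwa [hk] at hv⟩
        have i0 := ih _ _ _ h0'
        simp only [← hk] at i0
        rcases hLK (univ.filter fun v => ev s (fun b => Fin.tail (A b)) c v ≠ 0).card with hcase | hK
        · calc 2 ^ (F + 1) = 2 * 2 ^ F := by rw [pow_succ, mul_comm]
            _ ≤ 2 * (2 ^ L (s.filter fun b => A b 0 ≠ t₀).card
                  * (univ.filter fun v => ev s (fun b => Fin.tail (A b)) c v ≠ 0).card) :=
                Nat.mul_le_mul_left 2 i0
            _ ≤ 2 ^ L s.card * (univ.filter fun v => ev s (fun b => Fin.tail (A b)) c v ≠ 0).card := hcase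
            _ ≤ _ := Nat.mul_le_mul_left _ (Nat.le_add_right _ _)
        · exfalso
          obtain ⟨v, hv⟩ := h0'
          exact hv (hempty hK _ v)
    · -- `f(0,·) ≡ 0`: then `f(1,·) ≢ 0`; kill the major letter group of `f(1,·)`
      push Not at h0
      have h1 : ∃ v, ev s (fun b => Fin.tail (A b)) (fun b => c b * ω ^ (A b 0).val) v ≠ 0 := by
        by_contra h1
        push Not at h1
        obtain ⟨u, hu⟩ := hne
        exact hu (ev_eq_zero_of_restrictions s A c h0 h1 u)
      have hk := ev_kill_zero s (fun b => Fin.tail (A b)) c (fun b => A b 0) t₀ h0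
      have h1' : ∃ v, ev (s.filter fun b => A b 0 ≠ t₀) (fun b => Fin.tail (A b))
          (fun b => c b * (ω ^ (A b 0).val + ω ^ t₀.val)) v ≠ 0 := by
        obtain ⟨v, hv⟩ := h1
        exact ⟨v, by rwa [hk] at hv⟩
      have i1 := ih _ _ _ h1'
      simp only [← hk] at i1
      rcases hLK (univ.filter fun v =>
          ev s (fun b => Fin.tail (A b)) (fun b => c b * ω ^ (A b 0).val) v ≠ 0).card with hcase | hK
      · calc 2 ^ (F + 1) = 2 * 2 ^ F := by rw [pow_succ, mul_comm]
          _ ≤ 2 * (2 ^ L (s.filter fun b => A b 0 ≠ t₀).card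
                * (univ.filter fun v =>
                    ev s (fun b => Fin.tail (A b)) (fun b => c b * ω ^ (A b 0).val) v ≠ 0).card) :=
              Nat.mul_le_mul_left 2 i1
          _ ≤ 2 ^ L s.card * (univ.filter fun v =>
                ev s (fun b => Fin.tail (A b)) (fun b => c b * ω ^ (A b 0).val) v ≠ 0).card := hcase
          _ ≤ _ := Nat.mul_le_mul_left _ (Nat.le_add_left _ _)
      · exfalso
        obtain ⟨v, hv⟩ := h1'
        exact hv (hempty hK _ v)

/-- Packaged form used downstream: a `K`-term sum that is NOT identically `1` misses `1` on at least
`2^F / 2^{L (K+1)}` points (apply `sparse` to `f + 1`, one more term with the zero row). -/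
theorem sparse_ne_one (F : ℕ) (s : Finset ι) (A : ι → Fin F → ZMod 3) (c : ι → F4)
    (hne : ∃ u, ev s A c u ≠ 1) :
    2 ^ F ≤ 2 ^ L (s.card + 1) * (univ.filter fun u => ev s A c u ≠ 1).card := by
  -- index the extra constant term by `none`
  let s' : Finset (Option ι) := insertNone s
  let A' : Option ι → Fin F → ZMod 3 := fun o => o.elim (fun _ => 0) A
  let c' : Option ι → F4 := fun o => o.elim 1 c
  have hev : ∀ u, ev s' A' c' u = ev s A c u + 1 := by
    intro u
    unfold ev
    rw [Finset.sum_insertNone]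
    simp only [A', c', Option.elim]
    have hz : chiZ (fun _ : Fin F => (0 : ZMod 3)) u = 1 := by
      unfold chiZ expo
      simp only [ZMod.val_zero, ite_self, sum_const_zero, pow_zero]
    rw [hz, mul_one, add_comm]
  have hiff : ∀ u, ev s' A' c' u ≠ 0 ↔ ev s A c u ≠ 1 := by
    intro u
    rw [hev u, not_iff_not]
    constructor
    · intro h; linear_combination h - two_eq_zero
    · intro h; rw [h]; exact (add_self 1)
  have hne' : ∃ u, ev s' A' c' u ≠ 0 := by
    obtain ⟨u, hu⟩ := hne; exact ⟨u, (hiff u).2 hu⟩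
  have h := sparse F s' A' c' hne'
  have hcard : s'.card = s.card + 1 := Finset.card_insertNone s
  rw [hcard] at h
  have hfilt : (univ.filter fun u => ev s' A' c' u ≠ 0) = univ.filter fun u => ev s A c u ≠ 1 :=
    filter_congr fun u _ => hiff u
  rwa [hfilt] at h

/-! ### Arithmetic of the exponents -/

/-- `L K ≤ 2 log₂ K + 2`. -/
theorem L_le_log (K : ℕ) : L K ≤ 2 * Nat.log 2 K + 2 := by
  induction K using Nat.strong_induction_on with
  | _ K ih =>
    by_cases h1 : K ≤ 1
    · rw [L_of_le_one h1]; exact Nat.zero_le _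
    · rw [L_of_two_le (by omega)]
      by_cases h2 : 2 * K / 3 ≤ 1
      · rw [L_of_le_one h2]; omega
      · rw [L_of_two_le (by omega)]
        have hmono : L (2 * (2 * K / 3) / 3) ≤ L (K / 2) := L_mono (by omega)
        have hih : L (K / 2) ≤ 2 * Nat.log 2 (K / 2) + 2 := ih (K / 2) (by omega)
        have hlog : Nat.log 2 (K / 2) = Nat.log 2 K - 1 := Nat.log_div_base 2 K
        have hlog1 : 1 ≤ Nat.log 2 K := Nat.le_log_of_pow_le (by norm_num) (by omega)
        omega

/-- `2^{L K} ≤ 4 K²` for `K ≥ 1`. -/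
theorem two_pow_L_le (K : ℕ) (hK : 1 ≤ K) : 2 ^ L K ≤ 4 * K ^ 2 := by
  have h1 : 2 ^ L K ≤ 2 ^ (2 * Nat.log 2 K + 2) := Nat.pow_le_pow_right (by norm_num) (L_le_log K)
  have h2 : 2 ^ Nat.log 2 K ≤ K := Nat.pow_log_le_self 2 (by omega)
  calc 2 ^ L K ≤ 2 ^ (2 * Nat.log 2 K + 2) := h1
    _ = 4 * (2 ^ Nat.log 2 K) ^ 2 := by ring
    _ ≤ 4 * K ^ 2 := by
        have := Nat.pow_le_pow_left h2 2
        omega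

end Summit.QuantumAdvantage.AdviceFreeQNC0.AffBells37
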